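import Summits.ValiantsHypothesis.ValiantsHypothesis.Theorems.TwoProducts.RankThreeAffineToricWronskianRay

/-!
# Toric Wronskians of monomials, part 2: the CORNER COEFFICIENTS — generic families keep the edge directions of `u`

For `D = J(·,u)` (toric Jacobian, ✓ `jacDer`) and monomials `X^{e_0}, …, X^{e_{K−1}}`, every entry `D^k X^{e_i}` of the Wronskian matrix is
supported in `e_i + k·Newt(u)`, so `supp W_D(X^{e}) ⊆ Σe_i + N·Newt(u)`, `N = Σ_{i<K} i = C(K,2)`.  THIS FILE computes the coefficient of `W` at
each CORNER `Σe_i + N·v`, `v` a vertex of `Newt(u)` (the unique `ν`-top of `supp u`):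
★ `toricW_corner`: `W` is `ν`-dominated by `T = Σ_i (e_i + i•v)` and `coeff_T W = det (Vandermonde (β))`, `β_i = u_v · det(e_i, v)`
(each `D^k X^{e_i}` is `ν`-dominated by `e_i + k•v` with coefficient `β_i^k`, ★ `isDomTop_iterate_jacDer`; the permutation expansion of `det`).
Hence ★ `toricW_isUniqueTop_corner`: if the integers `det(e_i, v)` are pairwise distinct («no difference `e_i − e_j` parallel to the vertex
vector `v`» — the v-RESONANCES), the corner survives and `W` has a UNIQUE `ν`-top; so (★★ `toricW_Eset_subset_of_generic`) a family that is
non-resonant at every support point of `u` has `Eset σ W ⊆ Eset σ u`: the toric Wronskian has NO edge directions beyond those of `u` itself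
(`|Eset σ W| ≤ t²`, ★ `toricW_card_Eset_le_of_generic`) — Newton polygon of `W` = the full dilate `Σe + N·Newt(u)`.
HONEST SCOPE (crit-8 g5 #109 (n1)): as stated with `s` ranging over ALL of `supp u` the hypothesis is vacuous when `0 ∈ supp u`; §5 gives the
NORMALISED form (`J(·,u) = J(·,u − u(0))`, ★★ `toricW_Eset_subset_of_generic_S1`, conclusion `⊆ Eset σ (u − C (coeff 0 u))`), whose reach in the OLM
triangle of degree `m` is the thin class «every non-zero support vector of `u` has primitive part of ℓ¹-length `> m`».
This is the second discharge of the (TW-flag) hypothesis shape of the OLM column ladder (✓ `TWFlagBound`, p713956; ✓ (W1) `toricW_card_Eset_ray_le`,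
p711636, is the opposite extreme: all differences parallel to ONE direction), and it locates the residue EXACTLY: corners are cut only at
v-resonances `det(e_i − e_j, v) = 0`, `v ∈ vertices(Newt u)` — in the OLM triangle with `x, y ∈ supp u` these are the pairs of columns with equal
`y`- (resp. `x`-) exponent.  DATUM (scratch census `w14–w17.py`, job j329874, val-port-4 g5): for `t ≤ 5`, `K ≤ 8` and random / two-line / OLM-triangle
families the number of edges of `Newt W` never exceeded `#edges(Newt u) + 5` although `|supp W|` reached `C(N+t−1, t−1)`; the corner formula was
checked exactly on 116/116 random instances.  CONJECTURE (TW-flag, poly — residue sentence rev 4): `|Eset σ W| ≤ Q(K,t)` polynomial in `(K,t)`;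
the form ‹#edges(Newt u) + c·K› is FALSE already at `K = 2` (crit-8 g5 #109′: `Newt W₂ = conv(supp u ∖ ℝ(e₁−e₀))` can have `t−2` edges while `Newt u` has 4),
so `Q` must grow at least linearly in `t`.
HONEST LABEL: located cell / exact engine on the OPEN rung 3-AFF (side ladder, crux `stmt-ValiantsHypothesis-5906` `TwoProducts`); (TW-flag) at
resonant families, `OLMLaw`, `RankThreeAffineLaw(Exp)`, `TwoProducts`, PCB, `ResidualLawV25` UNMOVED; 0 summit distance; VP ≠ VNP is NOT proved.
`--supports stmt-ValiantsHypothesis-5906 --as helper` (val-port-4 g5; critic of record val-idea-crit-8 g5).  One new predicate (`IsDomTop`, the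
membership-free variant of ✓ `IsUniqueTop`, needed because partial permutation sums may cancel at the corner); no instances, no notation, no named
facts. [folklore]
-/

noncomputable section
set_option linter.dupNamespace false

namespace Summit.ValiantsHypothesis.ValiantsHypothesis.Theorems.TwoProducts.RankTwoJacobian

open scoped BigOperators
open MvPolynomial
open Literature.LinearAlgebra.Matrix (wronskianMatrix wronskian wronskianMatrix_apply wronskian_def)

section TowerKernel
open scoped Classical

/-! ### §1 Weak (membership-free) domination by a point -/

/-- `F` is `ν`-DOMINATED by the point `P`: every support point other than `P` is strictly lighter.  Unlike ✓ `IsUniqueTop`, `P ∈ supp F` is NOT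
required, so the predicate survives sums whose top coefficients cancel. [folklore] -/
def IsDomTop (ν : Fin 2 → ℝ) (F : Poly2) (P : Expo) : Prop := ∀ s ∈ F.support, s ≠ P → wt ν s < wt ν P

/-- a dominated polynomial is bounded by the weight of the dominating point. [folklore] -/
theorem IsDomTop.le {ν : Fin 2 → ℝ} {F : Poly2} {P : Expo} (h : IsDomTop ν F P) : ∀ s ∈ F.support, wt ν s ≤ wt ν P := by
  intro s hs
  by_cases hsP : s = P
  · rw [hsP]
  · exact le_of_lt (h s hs hsP)

/-- a unique top dominates. [folklore] -/
theorem isDomTop_of_isUniqueTop {ν : Fin 2 → ℝ} {F : Poly2} {P : Expo} (h : IsUniqueTop ν F P) : IsDomTop ν F P := h.2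

/-- domination plus a non-zero coefficient at the point is a unique top. [folklore] -/
theorem isUniqueTop_of_isDomTop {ν : Fin 2 → ℝ} {F : Poly2} {P : Expo} (h : IsDomTop ν F P) (hP : coeff P F ≠ 0) :
    IsUniqueTop ν F P :=
  ⟨MvPolynomial.mem_support_iff.mpr hP, h⟩

/-- domination passes to smaller supports. [folklore] -/
theorem isDomTop_of_support_subset {ν : Fin 2 → ℝ} {F G : Poly2} {P : Expo} (h : IsDomTop ν F P) (hG : G.support ⊆ F.support) :
    IsDomTop ν G P :=
  fun s hs hsP => h s (hG hs) hsP

/-- `0` is dominated by every point. [folklore] -/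
theorem isDomTop_zero (ν : Fin 2 → ℝ) (P : Expo) : IsDomTop ν (0 : Poly2) P := fun s hs _ => by simp at hs

/-- a monomial is dominated by its exponent. [folklore] -/
theorem isDomTop_monomial (ν : Fin 2 → ℝ) (P : Expo) (c : ℂ) : IsDomTop ν (monomial P c) P := by
  intro s hs hsP
  exact absurd (Finset.mem_singleton.mp (support_monomial_subset hs)) hsP

/-- `1` is dominated by `0`. [folklore] -/
theorem isDomTop_one (ν : Fin 2 → ℝ) : IsDomTop ν (1 : Poly2) 0 := by
  rw [← C_1, C_apply]; exact isDomTop_monomial ν 0 1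

/-- sums with the same dominating point. [folklore] -/
theorem isDomTop_add {ν : Fin 2 → ℝ} {F G : Poly2} {P : Expo} (hF : IsDomTop ν F P) (hG : IsDomTop ν G P) :
    IsDomTop ν (F + G) P := by
  intro s hs hsP
  rcases Finset.mem_union.mp (MvPolynomial.support_add hs) with h' | h'
  · exact hF s h' hsP
  · exact hG s h' hsP

/-- negation. [folklore] -/
theorem isDomTop_neg {ν : Fin 2 → ℝ} {F : Poly2} {P : Expo} (hF : IsDomTop ν F P) : IsDomTop ν (-F) P :=
  isDomTop_of_support_subset hF (by rw [MvPolynomial.support_neg])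

/-- a sign `w = ±1` (the `ℤˣ`-action of `Matrix.det_apply`): domination kept, coefficient multiplied. [folklore] -/
theorem isDomTop_units_smul {ν : Fin 2 → ℝ} {F : Poly2} {P : Expo} (hF : IsDomTop ν F P) (w : ℤˣ) :
    IsDomTop ν (w • F) P ∧ coeff P (w • F) = w • coeff P F := by
  rcases Int.units_eq_one_or w with h | h
  · subst h; rw [one_smul, one_smul]; exact ⟨hF, rfl⟩
  · subst h; rw [Units.neg_smul, one_smul, Units.neg_smul, one_smul, coeff_neg]; exact ⟨isDomTop_neg hF, rfl⟩

/-- finite sums with a common dominating point. [folklore] -/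
theorem isDomTop_sum {ι : Type*} (s : Finset ι) {ν : Fin 2 → ℝ} {g : ι → Poly2} {P : Expo}
    (h : ∀ i ∈ s, IsDomTop ν (g i) P) : IsDomTop ν (∑ i ∈ s, g i) P := by
  induction s using Finset.induction_on with
  | empty => rw [Finset.sum_empty]; exact isDomTop_zero ν P
  | insert a s ha ih =>
    rw [Finset.sum_insert ha]
    exact isDomTop_add (h a (Finset.mem_insert_self a s)) (ih fun i hi => h i (Finset.mem_insert_of_mem hi))

/-- ★ PRODUCTS: dominating points add, corner coefficients multiply (no membership needed). [folklore] -/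
theorem isDomTop_mul {ν : Fin 2 → ℝ} {F G : Poly2} {P Q : Expo} (hF : IsDomTop ν F P) (hG : IsDomTop ν G Q) :
    IsDomTop ν (F * G) (P + Q) ∧ coeff (P + Q) (F * G) = coeff P F * coeff Q G := by
  have huniq : ∀ a ∈ F.support, ∀ b ∈ G.support, a + b = P + Q → a = P ∧ b = Q := by
    intro a ha b hb hab
    have hsum : wt ν a + wt ν b = wt ν P + wt ν Q := by rw [← wt_add, ← wt_add, hab]
    by_contra hne
    rcases not_and_or.mp hne with h1 | h1
    · have := hF a ha h1; have := hG.le b hb; linarith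
    · have := hG b hb h1; have := hF.le a ha; linarith
  refine ⟨fun s hs hsPQ => ?_, coeff_mul_of_unique F G P Q huniq⟩
  obtain ⟨a, ha, b, hb, rfl⟩ := Finset.mem_add.mp (MvPolynomial.support_mul F G hs)
  rw [wt_add, wt_add]
  by_cases h1 : a = P
  · subst h1
    have hb' : b ≠ Q := fun h => hsPQ (by rw [h])
    have := hG b hb hb'; linarith
  · have := hF a ha h1; have := hG.le b hb; linarith

/-- ★ finite products: `∏ g_i` is dominated by `Σ P_i` with corner coefficient `∏ coeff_{P_i} g_i`. [folklore] -/
theorem isDomTop_prod {ι : Type*} (s : Finset ι) {ν : Fin 2 → ℝ} {g : ι → Poly2} {P : ι → Expo}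
    (h : ∀ i ∈ s, IsDomTop ν (g i) (P i)) :
    IsDomTop ν (∏ i ∈ s, g i) (∑ i ∈ s, P i) ∧ coeff (∑ i ∈ s, P i) (∏ i ∈ s, g i) = ∏ i ∈ s, coeff (P i) (g i) := by
  induction s using Finset.induction_on with
  | empty =>
    rw [Finset.prod_empty, Finset.sum_empty, Finset.prod_empty]
    exact ⟨isDomTop_one ν, by rw [← C_1, coeff_zero_C]⟩
  | insert a s ha ih =>
    obtain ⟨hd, hc⟩ := ih fun i hi => h i (Finset.mem_insert_of_mem hi)
    rw [Finset.prod_insert ha, Finset.sum_insert ha, Finset.prod_insert ha]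
    obtain ⟨hd', hc'⟩ := isDomTop_mul (h a (Finset.mem_insert_self a s)) hd
    exact ⟨hd', by rw [hc', hc]⟩

/-! ### §2 One toric-Jacobian step at a vertex of `Newt u` -/

/-- ★ THE J-STEP: if `F` is `ν`-dominated by `P` and `v` is the unique `ν`-top of `supp u`, then `J(F,u)` is `ν`-dominated by `P + v` with corner
coefficient `coeff_P F · u_v · det(P, v)`. [folklore] -/
theorem isDomTop_jac {ν : Fin 2 → ℝ} {F u : Poly2} {P v : Expo} (hF : IsDomTop ν F P) (hu : IsUniqueTop ν u v) :
    IsDomTop ν (jac F u) (P + v) ∧ coeff (P + v) (jac F u) = coeff P F * coeff v u * ((idet P v : ℤ) : ℂ) := by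
  have hdom : IsDomTop ν (jac F u) (P + v) := by
    intro z hz hzP
    obtain ⟨a, ha, b, hb, rfl⟩ := Finset.mem_add.mp (support_jac_subset F u hz)
    rw [wt_add, wt_add]
    by_cases h1 : a = P
    · subst h1
      have hb' : b ≠ v := fun h => hzP (by rw [h])
      have := hu.2 b hb hb'; linarith
    · have := hF a ha h1; have := hu.le b hb; linarith
  refine ⟨hdom, ?_⟩
  by_cases hP : P ∈ F.support
  · exact coeff_jac_uniqueTop ν F u v P hu hP hF.le
  · -- `P ∉ supp F`: everything in `supp J(F,u)` is strictly below `P + v`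
    have hzero : coeff (P + v) (jac F u) = 0 := by
      by_contra hne
      have hmem := MvPolynomial.mem_support_iff.mpr hne
      obtain ⟨a, ha, b, hb, hab⟩ := Finset.mem_add.mp (support_jac_subset F u hmem)
      have h1 : a ≠ P := fun h => hP (h ▸ ha)
      have hlt := hF a ha h1
      have hle := hu.le b hb
      have hw : wt ν a + wt ν b = wt ν P + wt ν v := by rw [← wt_add, ← wt_add, hab]
      linarith
    rw [hzero, MvPolynomial.notMem_support_iff.mp hP, zero_mul, zero_mul]

/-- `det(P + k•v, v) = det(P, v)`. [folklore] -/
theorem idet_add_nsmul_self (P v : Expo) (k : ℕ) : idet (P + k • v) v = idet P v := by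
  unfold idet
  simp only [Finsupp.add_apply, Finsupp.smul_apply, smul_eq_mul]
  push_cast
  ring

/-- ★ ITERATION: `D^k X^γ` (`D = J(·,u)`) is `ν`-dominated by `γ + k•v` with corner coefficient `(u_v · det(γ, v))^k`. -/
theorem isDomTop_iterate_jacDer {ν : Fin 2 → ℝ} {u : Poly2} {v : Expo} (hu : IsUniqueTop ν u v) (γ : Expo) (c : ℂ) :
    ∀ k : ℕ, IsDomTop ν ((⇑(jacDer u))^[k] (monomial γ c)) (γ + k • v) ∧
      coeff (γ + k • v) ((⇑(jacDer u))^[k] (monomial γ c)) = c * (coeff v u * ((idet γ v : ℤ) : ℂ)) ^ k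
  | 0 => by
    rw [Function.iterate_zero_apply, zero_smul, add_zero, pow_zero, mul_one, coeff_monomial, if_pos rfl]
    exact ⟨isDomTop_monomial ν γ c, rfl⟩
  | k + 1 => by
    obtain ⟨hd, hc⟩ := isDomTop_iterate_jacDer hu γ c k
    rw [Function.iterate_succ_apply', jacDer_apply]
    obtain ⟨hd', hc'⟩ := isDomTop_jac hd hu
    have he : γ + k • v + v = γ + (k + 1) • v := by rw [succ_nsmul, add_assoc]
    rw [he] at hd' hc'
    refine ⟨hd', ?_⟩
    rw [hc', hc, idet_add_nsmul_self, pow_succ]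
    ring

/-! ### §3 The corner of the Wronskian -/

/-- the corner weights `β_i = u_v · det(e_i, v)`. [folklore] -/
def toricWCornerWt (u : Poly2) (v : Expo) {K : ℕ} (e : Fin K → Expo) (i : Fin K) : ℂ := coeff v u * ((idet (e i) v : ℤ) : ℂ)

/-- ★★ **THE CORNER COEFFICIENT.** At a vertex `v` of `Newt u` (unique `ν`-top), `W_{J(·,u)}(X^{e_0},…,X^{e_{K−1}})` is `ν`-dominated by
`T = Σ_i (e_i + i•v)` and its coefficient there is the Vandermonde determinant `det (β_i^k) = Π_{i<j} (β_j − β_i)`, `β_i = u_v·det(e_i, v)`. -/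
theorem toricW_corner {ν : Fin 2 → ℝ} {u : Poly2} {v : Expo} (hu : IsUniqueTop ν u v) {K : ℕ} (e : Fin K → Expo) :
    IsDomTop ν (wronskian (⇑(jacDer u)) (fun i => monomial (e i) (1 : ℂ))) (∑ i : Fin K, (e i + (i : ℕ) • v)) ∧
      coeff (∑ i : Fin K, (e i + (i : ℕ) • v)) (wronskian (⇑(jacDer u)) (fun i => monomial (e i) (1 : ℂ))) =
        (Matrix.vandermonde (toricWCornerWt u v e)).det := by
  -- every permutation term is dominated by the same corner `T`
  have hT : ∀ σ : Equiv.Perm (Fin K), ∑ i : Fin K, (e i + ((σ i : Fin K) : ℕ) • v) = ∑ i : Fin K, (e i + (i : ℕ) • v) := by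
    intro σ
    rw [Finset.sum_add_distrib, Finset.sum_add_distrib, ← Finset.sum_smul, ← Finset.sum_smul]
    congr 2
    exact Equiv.sum_comp σ (fun i : Fin K => (i : ℕ))
  have hterm : ∀ σ : Equiv.Perm (Fin K),
      IsDomTop ν (Equiv.Perm.sign σ • ∏ i : Fin K, wronskianMatrix (⇑(jacDer u)) (fun i => monomial (e i) (1 : ℂ)) (σ i) i)
        (∑ i : Fin K, (e i + (i : ℕ) • v)) ∧
      coeff (∑ i : Fin K, (e i + (i : ℕ) • v))
        (Equiv.Perm.sign σ • ∏ i : Fin K, wronskianMatrix (⇑(jacDer u)) (fun i => monomial (e i) (1 : ℂ)) (σ i) i) =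
        Equiv.Perm.sign σ • ∏ i : Fin K, toricWCornerWt u v e i ^ ((σ i : Fin K) : ℕ) := by
    intro σ
    have hp := isDomTop_prod (Finset.univ : Finset (Fin K)) (ν := ν)
      (g := fun i => wronskianMatrix (⇑(jacDer u)) (fun i => monomial (e i) (1 : ℂ)) (σ i) i)
      (P := fun i => e i + ((σ i : Fin K) : ℕ) • v)
      (fun i _ => by rw [wronskianMatrix_apply]; exact (isDomTop_iterate_jacDer hu (e i) 1 (σ i)).1)
    rw [hT σ] at hp
    obtain ⟨hd, hc⟩ := hp
    obtain ⟨hd', hc'⟩ := isDomTop_units_smul hd (Equiv.Perm.sign σ)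
    refine ⟨hd', ?_⟩
    rw [hc', hc]
    congr 1
    refine Finset.prod_congr rfl fun i _ => ?_
    rw [wronskianMatrix_apply, (isDomTop_iterate_jacDer hu (e i) 1 (σ i)).2, one_mul]
    rfl
  rw [wronskian_def, Matrix.det_apply, ← Matrix.det_transpose (Matrix.vandermonde _), Matrix.det_apply]
  refine ⟨isDomTop_sum _ fun σ _ => (hterm σ).1, ?_⟩
  rw [coeff_sum]
  refine Finset.sum_congr rfl fun σ _ => ?_
  rw [(hterm σ).2]
  rfl

/-- ★ **GENERIC CORNERS SURVIVE:** if `v ∈ supp u` is the unique `ν`-top and the integers `det(e_i, v)` are pairwise distinct (no difference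
`e_i − e_j` parallel to `v`), then `W` has the UNIQUE `ν`-top `Σ_i (e_i + i•v)`. -/
theorem toricW_isUniqueTop_corner {ν : Fin 2 → ℝ} {u : Poly2} {v : Expo} (hu : IsUniqueTop ν u v) {K : ℕ} (e : Fin K → Expo)
    (hgen : ∀ i j : Fin K, idet (e i) v = idet (e j) v → i = j) :
    IsUniqueTop ν (wronskian (⇑(jacDer u)) (fun i => monomial (e i) (1 : ℂ))) (∑ i : Fin K, (e i + (i : ℕ) • v)) := by
  obtain ⟨hd, hc⟩ := toricW_corner hu e
  refine isUniqueTop_of_isDomTop hd ?_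
  rw [hc, Ne, Matrix.det_vandermonde_eq_zero_iff]
  rintro ⟨i, j, hij, hne⟩
  have huv : coeff v u ≠ 0 := MvPolynomial.mem_support_iff.mp hu.1
  unfold toricWCornerWt at hij
  have h' : ((idet (e i) v : ℤ) : ℂ) = ((idet (e j) v : ℤ) : ℂ) := mul_left_cancel₀ huv hij
  exact hne (hgen i j (by exact_mod_cast h'))

/-! ### §4 Edge directions of generic toric Wronskians -/

/-- a non-zero polynomial without a tie in direction `ν` has a unique `ν`-top (= the Cruxes-workfile lemma `ValIdea35g10.exists_isUniqueTop_of_not_isEdgeDir`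
of val-idea-35 g11, restated here because Theorems never import Cruxes). [folklore] -/
theorem exists_isUniqueTop_of_not_isEdgeDir {ν : Fin 2 → ℝ} {u : Poly2} (hu : u ≠ 0) (hν : ¬ IsEdgeDir ν u) :
    ∃ v, IsUniqueTop ν u v := by
  obtain ⟨p, hp, hmax⟩ := Finset.exists_max_image u.support (wt ν) (support_nonempty.mpr hu)
  refine ⟨p, hp, fun s hs hsp => lt_of_le_of_ne (hmax s hs) fun h => hν ?_⟩
  exact ⟨p, hp, s, hs, Ne.symm hsp, hmax, h⟩

/-- ★★ **GENERIC FAMILIES KEEP THE EDGE DIRECTIONS OF `u`:** if no difference `e_i − e_j` (`i ≠ j`) is parallel to a support vector of `u`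
(`det(e_i, s) ≠ det(e_j, s)` for all `s ∈ supp u`), then every edge direction of `W_{J(·,u)}(X^e)` is an edge direction of `u`. -/
theorem toricW_Eset_subset_of_generic {σ : ℝ} (hσ : σ = 1 ∨ σ = -1) (u : Poly2) {K : ℕ} (e : Fin K → Expo)
    (hgen : ∀ s ∈ u.support, ∀ i j : Fin K, idet (e i) s = idet (e j) s → i = j) :
    Eset σ (wronskian (⇑(jacDer u)) (fun i => monomial (e i) (1 : ℂ))) ⊆ Eset σ u := by
  intro μ hμ
  by_contra hμu
  have hW := (mem_Eset hσ).mp hμ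
  by_cases hu0 : u = 0
  · -- `u = 0`: `D = 0`, the Wronskian is a constant (`K ≤ 1`) or `0`, no edge directions
    subst hu0
    apply hμu
    exfalso
    rcases Nat.lt_or_ge K 2 with hK | hK
    · -- K = 0 or 1: W is `1` or a monomial
      obtain ⟨p, hp, q, hq, hpq, -, -⟩ := hW
      have hsub : (wronskian (⇑(jacDer (0 : Poly2))) (fun i => monomial (e i) (1 : ℂ))).support.card ≤ 1 := by
        interval_cases K
        · rw [wronskian_def, Matrix.det_fin_zero, ← C_1, C_apply]
          exact (Finset.card_le_card support_monomial_subset).trans (Finset.card_singleton _).le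
        · rw [wronskian_def, Matrix.det_fin_one, wronskianMatrix_apply]
          show (((⇑(jacDer (0 : Poly2)))^[0]) (monomial (e 0) (1 : ℂ))).support.card ≤ 1
          rw [Function.iterate_zero_apply]
          exact (Finset.card_le_card support_monomial_subset).trans (Finset.card_singleton _).le
      exact hpq (Finset.card_le_one.mp hsub p hp q hq)
    · -- K ≥ 2: row 1 of the Wronskian matrix is `J(X^{e_i}, 0) = 0`, so `W = 0`
      obtain ⟨p, hp, -, -, -, -, -⟩ := hW
      have hzero : wronskian (⇑(jacDer (0 : Poly2))) (fun i => monomial (e i) (1 : ℂ)) = 0 := by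
        rw [wronskian_def]
        refine Matrix.det_eq_zero_of_row_eq_zero ⟨1, hK⟩ fun j => ?_
        rw [wronskianMatrix_apply]
        show ((⇑(jacDer (0 : Poly2)))^[1]) (monomial (e j) (1 : ℂ)) = 0
        rw [Function.iterate_one, jacDer_apply]
        unfold jac theta
        simp
      rw [hzero, support_zero] at hp
      exact absurd hp (Finset.notMem_empty _)
  · have hν : ¬ IsEdgeDir (dir σ μ) u := fun h => hμu ((mem_Eset hσ).mpr h)
    obtain ⟨v, hv⟩ := exists_isUniqueTop_of_not_isEdgeDir hu0 hν
    have htop := toricW_isUniqueTop_corner hv e (hgen v hv.1)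
    exact not_tie_of_utop ((isUniqueTop_iff _ _ _).mp htop) ((isEdgeDir_iff_tie _ _).mp hW)

/-- ★ hence `|Eset σ W| ≤ |supp u|²` for generic families — a discharge of the (TW-flag) shape off all v-resonances. -/
theorem toricW_card_Eset_le_of_generic {σ : ℝ} (hσ : σ = 1 ∨ σ = -1) (u : Poly2) {K : ℕ} (e : Fin K → Expo)
    (hgen : ∀ s ∈ u.support, ∀ i j : Fin K, idet (e i) s = idet (e j) s → i = j) :
    (Eset σ (wronskian (⇑(jacDer u)) (fun i => monomial (e i) (1 : ℂ)))).card ≤ u.support.card * u.support.card :=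
  (Finset.card_le_card (toricW_Eset_subset_of_generic hσ u e hgen)).trans (card_Eset_le σ u)

/-! ### §5 Normalisation `u ↦ u − u(0)`: the honest form of the hypothesis

`hgen` above quantifies over ALL `s ∈ supp u`; at `s = 0` it reads `det(e_i, 0) = det(e_j, 0) → i = j`, i.e. it is VACUOUS as soon as
`0 ∈ supp u` and `K ≥ 2` (val-idea-crit-8 g5 #109 (n1)).  But `J(·,u) = J(·,u − C(u 0))`, so the intended statement is for `u` normalised to
`u(0) = 0`, with conclusion `Eset σ W ⊆ Eset σ (u − C (coeff 0 u))` (NOT `⊆ Eset σ u`: removing the vertex `0` can create an edge).  HONEST REACH in the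
OLM triangle (columns `{(a,b) : a + b ≤ m}`): the normalised hypothesis says every non-zero support vector of `u` has primitive part of ℓ¹-length
`> m` — a thin class («`u` with only long primitive support directions»); the v-resonant families are the residue. -/

/-- antisymmetry `J(F,G) = −J(G,F)`. [folklore] -/
theorem jac_antisymm (F G : Poly2) : jac F G = -jac G F := by
  unfold jac; ring

/-- `J(F, C c) = 0`. [folklore] -/
theorem jac_C_right (F : Poly2) (c : ℂ) : jac F (C c) = 0 := by
  rw [jac_antisymm, jac_C_left, neg_zero]

/-- `J(F, G − H) = J(F,G) − J(F,H)`. [folklore] -/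
theorem jac_sub_right (F G H : Poly2) : jac F (G - H) = jac F G - jac F H := by
  rw [jac_antisymm, jac_sub_left, jac_antisymm G F, jac_antisymm H F]; ring

/-- ★ the toric Jacobian derivation does not see the constant term: `J(·, u − C c) = J(·, u)`. [folklore] -/
theorem jacDer_sub_C (u : Poly2) (c : ℂ) : jacDer (u - C c) = jacDer u := by
  refine Derivation.ext fun F => ?_
  rw [jacDer_apply, jacDer_apply, jac_sub_right, jac_C_right, sub_zero]

/-- the support of `u − C (u 0)` is the non-constant support of `u`. [folklore] -/
theorem mem_support_sub_C_coeff_zero {u : Poly2} {s : Expo} (hs : s ∈ (u - C (coeff 0 u)).support) : s ∈ u.support ∧ s ≠ 0 := by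
  rw [MvPolynomial.mem_support_iff, coeff_sub, coeff_C] at hs
  by_cases h0 : s = 0
  · subst h0; rw [if_pos rfl, sub_self] at hs; exact absurd rfl hs
  · rw [if_neg (Ne.symm h0), sub_zero] at hs
    exact ⟨MvPolynomial.mem_support_iff.mpr hs, h0⟩

/-- ★★ **NORMALISED FORM:** if no difference `e_i − e_j` (`i ≠ j`) is parallel to a NON-ZERO support vector of `u`, then every edge direction of
`W_{J(·,u)}(X^e)` is an edge direction of `u − u(0)`. -/
theorem toricW_Eset_subset_of_generic_S1 {σ : ℝ} (hσ : σ = 1 ∨ σ = -1) (u : Poly2) {K : ℕ} (e : Fin K → Expo)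
    (hgen : ∀ s ∈ u.support, s ≠ 0 → ∀ i j : Fin K, idet (e i) s = idet (e j) s → i = j) :
    Eset σ (wronskian (⇑(jacDer u)) (fun i => monomial (e i) (1 : ℂ))) ⊆ Eset σ (u - C (coeff 0 u)) := by
  rw [← jacDer_sub_C u (coeff 0 u)]
  exact toricW_Eset_subset_of_generic hσ _ e fun s hs => hgen s (mem_support_sub_C_coeff_zero hs).1 (mem_support_sub_C_coeff_zero hs).2

/-- ★ hence `|Eset σ W| ≤ |supp u|²` under the normalised (non-vacuous) hypothesis. -/
theorem toricW_card_Eset_le_of_generic_S1 {σ : ℝ} (hσ : σ = 1 ∨ σ = -1) (u : Poly2) {K : ℕ} (e : Fin K → Expo)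
    (hgen : ∀ s ∈ u.support, s ≠ 0 → ∀ i j : Fin K, idet (e i) s = idet (e j) s → i = j) :
    (Eset σ (wronskian (⇑(jacDer u)) (fun i => monomial (e i) (1 : ℂ)))).card ≤ u.support.card * u.support.card := by
  refine (Finset.card_le_card (toricW_Eset_subset_of_generic_S1 hσ u e hgen)).trans ((card_Eset_le σ _).trans ?_)
  have hsub : (u - C (coeff 0 u)).support ⊆ u.support := fun s hs => (mem_support_sub_C_coeff_zero hs).1
  exact Nat.mul_le_mul (Finset.card_le_card hsub) (Finset.card_le_card hsub)

end TowerKernel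

end Summit.ValiantsHypothesis.ValiantsHypothesis.Theorems.TwoProducts.RankTwoJacobian

end
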